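import Literature.RepresentationTheory.ModularTensorCategories.KLRacahNormReduce
import Literature.RepresentationTheory.ModularTensorCategories.TemperleyLieb.RootOfUnity

/-!
# Proofs of the Kauffman–Lins orthogonality and pentagon identities (`KLOrthogonality_holds`, `KLPentagon_holds`)

`Σ_i {a b i; c d j}_q {d a k'; b c i}_q = δ_{k'j}` at `q = e^{iπ/(k+2)}` ([cite: KauffmanLins1994, §7.3 Prop. 9, §9.13]),
for the Kauffman–Lins `q`-6j symbols `sixjKL` of `KLRecoupling.lean`.

The printed proof (recoupling twice in a `θ`-net, using the bubble/`θ` identities of the Temperley–Lieb category at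
the root of unity) is replaced by the classical evaluation of these 6j-symbols as `q`-Racah sums: by
`tetNet_eq`, `Tet[a b i; c d j] = f(i) g(j) S_{ij} / ([a]![b]![c]![d]!)` with `S_{ij} = racahSum k a b j c d i` and
explicit factorial weights `f, g` (`tetNet_eq_fg`); the `Δ/θθ` factors of the two 6j-symbols combine with `f², g²`
into the weights `ṽ_i, v_j` of the orthogonality relation `racahSum_gram` (`Σ_i ṽ_i S_{ij} S_{ij'} = δ_{jj'}/v_j`,
proved in `KLRacah*.lean` from the three-term recurrence of the Racah sums, a spectral argument, and Rogers' `₆φ₅` sum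
for the norm of an extremal column), and everything collapses to `δ_{k'j}`. Level `k = 0` is the trivial one-label
case. No named facts are introduced; this file discharges the named fact `KLOrthogonality`.

The pentagon [cite: KauffmanLins1994, §7.3 Prop. 10, §9.14] is discharged in the last section from the tree's binor-model
Temperley–Lieb recoupling theory (`TemperleyLieb/RootOfUnity.lean`, `pentagon_klA`) through the bridge `sixjKL_eq_Fco`;
this file therefore discharges both named facts of `KLRecoupling.lean`.
-/

noncomputable section

namespace Literature.RepresentationTheory.ModularTensorCategories.SU2LevelK

open Finset

variable (k : ℕ)

/-- `θ(x,y,z) ≠ 0` for an admissible triad. [cite: KauffmanLins1994, §9.10 (i)] -/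
theorem thetaNet_ne_zero {x y z : ℕ} (h : Adm k x y z) : thetaNet k x y z ≠ 0 := by
  rw [thetaNet_eq_sign_mul k h]
  exact mul_ne_zero (pow_ne_zero _ (by norm_num)) (thetaPos k h).ne'

/-- The row factor `f(i) = [(d+i-a)/2]! [(b+i-c)/2]! [(c+i-b)/2]! [(a+i-d)/2]! [(b+c-i)/2]! [(a+d-i)/2]! / [i]!` of the
tetrahedral net. [cite: KauffmanLins1994, §9.11] -/
def fFun (a b c d i : ℕ) : ℝ :=
  qFactorial k ((d + i - a) / 2) * qFactorial k ((b + i - c) / 2) * qFactorial k ((c + i - b) / 2) *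
    qFactorial k ((a + i - d) / 2) * qFactorial k ((b + c - i) / 2) * qFactorial k ((a + d - i) / 2) / qFactorial k i

/-- The column factor `g(j) = [(b+j-a)/2]! [(d+j-c)/2]! [(c+j-d)/2]! [(a+j-b)/2]! [(c+d-j)/2]! [(a+b-j)/2]! / [j]!`.
[cite: KauffmanLins1994, §9.11] -/
def gFun (a b c d j : ℕ) : ℝ :=
  qFactorial k ((b + j - a) / 2) * qFactorial k ((d + j - c) / 2) * qFactorial k ((c + j - d) / 2) *
    qFactorial k ((a + j - b) / 2) * qFactorial k ((c + d - j) / 2) * qFactorial k ((a + b - j) / 2) / qFactorial k j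

/-- **The tetrahedral net factorises**: `Tet[a b i; c d j] = f(i) g(j) S_{ij} / ([a]![b]![c]![d]!)` for admissible
`(a,d,i), (b,c,i), (a,b,j), (c,d,j)`. [cite: KauffmanLins1994, §9.11] -/
theorem tetNet_eq_fg {a b c d i j : ℕ} (hadi : Adm k a d i) (hbci : Adm k b c i) (habj : Adm k a b j)
    (hcdj : Adm k c d j) :
    tetNet k a b i c d j = fFun k a b c d i * gFun k a b c d j /
      (qFactorial k a * qFactorial k b * qFactorial k c * qFactorial k d) * racahSum k a b j c d i := by
  rw [tetNet_eq]
  unfold Adm at hadi hbci habj hcdj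
  obtain ⟨p1, t1, t2, t3, l1⟩ := hadi
  obtain ⟨p2, s1, s2, s3, l2⟩ := hbci
  obtain ⟨p3, u1, u2, u3, l3⟩ := habj
  obtain ⟨p4, w1, w2, w3, l4⟩ := hcdj
  unfold fFun gFun
  -- the four half-sums as variables (no parities, no divisions left)
  obtain ⟨α₁, hα₁⟩ : ∃ t, a + d + i = 2 * t := ⟨(a + d + i) / 2, by omega⟩
  obtain ⟨α₂, hα₂⟩ : ∃ t, b + c + i = 2 * t := ⟨(b + c + i) / 2, by omega⟩
  obtain ⟨α₃, hα₃⟩ : ∃ t, a + b + j = 2 * t := ⟨(a + b + j) / 2, by omega⟩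
  obtain ⟨α₄, hα₄⟩ : ∃ t, c + d + j = 2 * t := ⟨(c + d + j) / 2, by omega⟩
  clear p1 p2 p3 p4
  rw [show (a + d + i) / 2 = α₁ by omega, show (b + c + i) / 2 = α₂ by omega, show (a + b + j) / 2 = α₃ by omega,
    show (c + d + j) / 2 = α₄ by omega, show (b + d + i + j) / 2 = α₁ + α₃ - a by omega,
    show (a + c + i + j) / 2 = α₁ + α₄ - d by omega, show (a + b + c + d) / 2 = α₁ + α₂ - i by omega,
    show (d + i - a) / 2 = α₁ - a by omega, show (b + i - c) / 2 = α₂ - c by omega,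
    show (c + i - b) / 2 = α₂ - b by omega, show (a + i - d) / 2 = α₁ - d by omega,
    show (b + c - i) / 2 = α₂ - i by omega, show (a + d - i) / 2 = α₁ - i by omega,
    show (b + j - a) / 2 = α₃ - a by omega, show (d + j - c) / 2 = α₄ - c by omega,
    show (c + j - d) / 2 = α₄ - d by omega, show (a + j - b) / 2 = α₃ - b by omega,
    show (c + d - j) / 2 = α₄ - j by omega, show (a + b - j) / 2 = α₃ - j by omega]
  rw [show α₁ + α₃ - a - α₁ = α₃ - a by omega, show α₁ + α₃ - a - α₂ = α₄ - c by omega,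
    show α₁ + α₃ - a - α₃ = α₁ - a by omega, show α₁ + α₃ - a - α₄ = α₂ - c by omega,
    show α₁ + α₄ - d - α₁ = α₄ - d by omega, show α₁ + α₄ - d - α₂ = α₃ - b by omega,
    show α₁ + α₄ - d - α₃ = α₂ - b by omega, show α₁ + α₄ - d - α₄ = α₁ - d by omega,
    show α₁ + α₂ - i - α₁ = α₂ - i by omega, show α₁ + α₂ - i - α₂ = α₁ - i by omega,
    show α₁ + α₂ - i - α₃ = α₄ - j by omega, show α₁ + α₂ - i - α₄ = α₃ - j by omega]
  generalize qFactorial k i = Fi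
  generalize qFactorial k j = Fj
  generalize qFactorial k a = Fa
  generalize qFactorial k b = Fb
  generalize qFactorial k c = Fc
  generalize qFactorial k d = Fd
  generalize qFactorial k (α₃ - a) = G1
  generalize qFactorial k (α₄ - c) = G2
  generalize qFactorial k (α₁ - a) = F1
  generalize qFactorial k (α₂ - c) = F2
  generalize qFactorial k (α₄ - d) = G3
  generalize qFactorial k (α₃ - b) = G4
  generalize qFactorial k (α₂ - b) = F3
  generalize qFactorial k (α₁ - d) = F4
  generalize qFactorial k (α₂ - i) = F5
  generalize qFactorial k (α₁ - i) = F6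
  generalize qFactorial k (α₄ - j) = G5
  generalize qFactorial k (α₃ - j) = G6
  generalize racahSum k a b j c d i = S
  ring

/-- **The row weight**: `Δ_i f(i)² / (θ(a,d,i) θ(b,c,i)) = (-1)^{(a+b+c+d)/2} [a]![b]![c]![d]! · ṽ_i` with
`ṽ_i = racahV k a d c b i`. [cite: KauffmanLins1994, §9.10–9.12] -/
theorem sixj_row_weight {a b c d i : ℕ} (hadi : Adm k a d i) (hbci : Adm k b c i) :
    klDelta k i / (thetaNet k a d i * thetaNet k b c i) * (fFun k a b c d i * fFun k a b c d i) =
      (-1 : ℝ) ^ ((a + b + c + d) / 2) * (qFactorial k a * qFactorial k b * qFactorial k c * qFactorial k d) *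
        racahV k a d c b i := by
  rw [thetaNet_eq_sign_mul k hadi, thetaNet_eq_sign_mul k hbci]
  unfold Adm at hadi hbci
  obtain ⟨p1, t1, t2, t3, l1⟩ := hadi
  obtain ⟨p2, s1, s2, s3, l2⟩ := hbci
  unfold klDelta fFun racahV
  -- signs: `(-1)^i = (-1)^{(a+b+c+d)/2} (-1)^{(a+d+i)/2} (-1)^{(b+c+i)/2}`
  have hsign : (-1 : ℝ) ^ i = (-1) ^ ((a + b + c + d) / 2) * ((-1) ^ ((a + d + i) / 2) * (-1) ^ ((b + c + i) / 2)) := by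
    rw [← pow_add, ← pow_add, show (a + b + c + d) / 2 + ((a + d + i) / 2 + (b + c + i) / 2) =
      2 * ((a + b + c + d) / 2) + i by omega, pow_add, pow_mul]
    simp
  rw [hsign]
  rw [show (c + b - i) / 2 = (b + c - i) / 2 by rw [Nat.add_comm c b],
    show (c + b + i) / 2 = (b + c + i) / 2 by rw [Nat.add_comm c b]]
  have hs0 : (-1 : ℝ) ^ ((a + b + c + d) / 2) ≠ 0 := pow_ne_zero _ (by norm_num)
  have hs1 : (-1 : ℝ) ^ ((a + d + i) / 2) ≠ 0 := pow_ne_zero _ (by norm_num)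
  have hs2 : (-1 : ℝ) ^ ((b + c + i) / 2) ≠ 0 := pow_ne_zero _ (by norm_num)
  have h1 : qFactorial k ((a + d + i) / 2 + 1) ≠ 0 := (qFactorial_pos k (by omega)).ne'
  have h2 : qFactorial k ((b + c + i) / 2 + 1) ≠ 0 := (qFactorial_pos k (by omega)).ne'
  have h3 : qFactorial k ((a + d - i) / 2) ≠ 0 := (qFactorial_pos k (by omega)).ne'
  have h4 : qFactorial k ((d + i - a) / 2) ≠ 0 := (qFactorial_pos k (by omega)).ne'
  have h5 : qFactorial k ((a + i - d) / 2) ≠ 0 := (qFactorial_pos k (by omega)).ne'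
  have h6 : qFactorial k ((b + c - i) / 2) ≠ 0 := (qFactorial_pos k (by omega)).ne'
  have h7 : qFactorial k ((c + i - b) / 2) ≠ 0 := (qFactorial_pos k (by omega)).ne'
  have h8 : qFactorial k ((b + i - c) / 2) ≠ 0 := (qFactorial_pos k (by omega)).ne'
  have h9 : qFactorial k i ≠ 0 := (qFactorial_pos k (by omega)).ne'
  have h10 : qFactorial k a ≠ 0 := (qFactorial_pos k (by omega)).ne'
  have h11 : qFactorial k b ≠ 0 := (qFactorial_pos k (by omega)).ne'
  have h12 : qFactorial k c ≠ 0 := (qFactorial_pos k (by omega)).ne'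
  have h13 : qFactorial k d ≠ 0 := (qFactorial_pos k (by omega)).ne'
  generalize (-1 : ℝ) ^ ((a + b + c + d) / 2) = σ at *
  generalize (-1 : ℝ) ^ ((a + d + i) / 2) = σ₁ at *
  generalize (-1 : ℝ) ^ ((b + c + i) / 2) = σ₂ at *
  generalize qFactorial k ((a + d + i) / 2 + 1) = A1 at *
  generalize qFactorial k ((b + c + i) / 2 + 1) = A2 at *
  generalize qFactorial k ((a + d - i) / 2) = F6 at *
  generalize qFactorial k ((d + i - a) / 2) = F1 at *
  generalize qFactorial k ((a + i - d) / 2) = F4 at *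
  generalize qFactorial k ((b + c - i) / 2) = F5 at *
  generalize qFactorial k ((c + i - b) / 2) = F3 at *
  generalize qFactorial k ((b + i - c) / 2) = F2 at *
  generalize qFactorial k i = Fi at *
  generalize qFactorial k a = Fa at *
  generalize qFactorial k b = Fb at *
  generalize qFactorial k c = Fc at *
  generalize qFactorial k d = Fd at *
  generalize qInt k (i + 1) = Q at *
  field_simp

/-- **The column weight**: `Δ_j g(j)² / (θ(d,c,j) θ(a,b,j)) = (-1)^{(a+b+c+d)/2} [a]![b]![c]![d]! · v_j` with
`v_j = racahV k a b c d j`. [cite: KauffmanLins1994, §9.10–9.12] -/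
theorem sixj_col_weight {a b c d j : ℕ} (habj : Adm k a b j) (hcdj : Adm k c d j) :
    klDelta k j / (thetaNet k d c j * thetaNet k a b j) * (gFun k a b c d j * gFun k a b c d j) =
      (-1 : ℝ) ^ ((a + b + c + d) / 2) * (qFactorial k a * qFactorial k b * qFactorial k c * qFactorial k d) *
        racahV k a b c d j := by
  have hdcj : Adm k d c j := (adm_comm k).mp hcdj
  rw [thetaNet_eq_sign_mul k hdcj, thetaNet_eq_sign_mul k habj]
  unfold Adm at habj hcdj
  obtain ⟨p1, t1, t2, t3, l1⟩ := habj
  obtain ⟨p2, s1, s2, s3, l2⟩ := hcdj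
  unfold klDelta gFun racahV
  have hsign : (-1 : ℝ) ^ j = (-1) ^ ((a + b + c + d) / 2) * ((-1) ^ ((d + c + j) / 2) * (-1) ^ ((a + b + j) / 2)) := by
    rw [← pow_add, ← pow_add, show (a + b + c + d) / 2 + ((d + c + j) / 2 + (a + b + j) / 2) =
      2 * ((a + b + c + d) / 2) + j by omega, pow_add, pow_mul]
    simp
  rw [hsign]
  rw [show (d + c + j) / 2 = (c + d + j) / 2 by rw [Nat.add_comm d c],
    show (d + c - j) / 2 = (c + d - j) / 2 by rw [Nat.add_comm d c]]
  have hs0 : (-1 : ℝ) ^ ((a + b + c + d) / 2) ≠ 0 := pow_ne_zero _ (by norm_num)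
  have hs1 : (-1 : ℝ) ^ ((c + d + j) / 2) ≠ 0 := pow_ne_zero _ (by norm_num)
  have hs2 : (-1 : ℝ) ^ ((a + b + j) / 2) ≠ 0 := pow_ne_zero _ (by norm_num)
  have h1 : qFactorial k ((c + d + j) / 2 + 1) ≠ 0 := (qFactorial_pos k (by omega)).ne'
  have h2 : qFactorial k ((a + b + j) / 2 + 1) ≠ 0 := (qFactorial_pos k (by omega)).ne'
  have h3 : qFactorial k ((c + d - j) / 2) ≠ 0 := (qFactorial_pos k (by omega)).ne'
  have h4 : qFactorial k ((c + j - d) / 2) ≠ 0 := (qFactorial_pos k (by omega)).ne'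
  have h5 : qFactorial k ((d + j - c) / 2) ≠ 0 := (qFactorial_pos k (by omega)).ne'
  have h6 : qFactorial k ((a + b - j) / 2) ≠ 0 := (qFactorial_pos k (by omega)).ne'
  have h7 : qFactorial k ((b + j - a) / 2) ≠ 0 := (qFactorial_pos k (by omega)).ne'
  have h8 : qFactorial k ((a + j - b) / 2) ≠ 0 := (qFactorial_pos k (by omega)).ne'
  have h9 : qFactorial k j ≠ 0 := (qFactorial_pos k (by omega)).ne'
  have h10 : qFactorial k a ≠ 0 := (qFactorial_pos k (by omega)).ne'
  have h11 : qFactorial k b ≠ 0 := (qFactorial_pos k (by omega)).ne'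
  have h12 : qFactorial k c ≠ 0 := (qFactorial_pos k (by omega)).ne'
  have h13 : qFactorial k d ≠ 0 := (qFactorial_pos k (by omega)).ne'
  generalize (-1 : ℝ) ^ ((a + b + c + d) / 2) = σ at *
  generalize (-1 : ℝ) ^ ((c + d + j) / 2) = σ₁ at *
  generalize (-1 : ℝ) ^ ((a + b + j) / 2) = σ₂ at *
  generalize qFactorial k ((c + d + j) / 2 + 1) = A1 at *
  generalize qFactorial k ((a + b + j) / 2 + 1) = A2 at *
  generalize qFactorial k ((c + d - j) / 2) = G5 at *
  generalize qFactorial k ((c + j - d) / 2) = G3 at *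
  generalize qFactorial k ((d + j - c) / 2) = G2 at *
  generalize qFactorial k ((a + b - j) / 2) = G6 at *
  generalize qFactorial k ((b + j - a) / 2) = G1 at *
  generalize qFactorial k ((a + j - b) / 2) = G4 at *
  generalize qFactorial k j = Fj at *
  generalize qFactorial k a = Fa at *
  generalize qFactorial k b = Fb at *
  generalize qFactorial k c = Fc at *
  generalize qFactorial k d = Fd at *
  generalize qInt k (j + 1) = Q at *
  field_simp

/-- Level `0`: the only labels are `0` and `{0 0 0; 0 0 0}_q = 1`. [cite: KauffmanLins1994, §9.12] -/
theorem sixjKL_zero : sixjKL 0 0 0 0 0 0 0 = 1 := by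
  unfold sixjKL
  rw [if_pos (by unfold Adm; omega)]
  unfold tetNet thetaNet klDelta
  simp [qFactorial_zero, qFactorial_succ, qInt_one]

/-- **The Kauffman–Lins orthogonality identity holds**: `Σ_i {a b i; c d j}_q {d a k'; b c i}_q = δ_{k'j}` at
`q = e^{iπ/(k+2)}` for q-admissible `(a,b,j), (c,d,j)` and all labels `≤ k`.
[cite: KauffmanLins1994, §7.3 Prop. 9 (Orthogonality Identity), §9.13] -/
theorem KLOrthogonality_holds : KLOrthogonality k := by
  intro a b c d j k' ha hb hc hd hk' habj hcdj
  rcases Nat.eq_zero_or_pos k with hk0 | hk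
  · -- level 0
    subst hk0
    have ha0 : a = 0 := by omega
    have hb0 : b = 0 := by omega
    have hc0 : c = 0 := by omega
    have hd0 : d = 0 := by omega
    have hk0' : k' = 0 := by omega
    subst ha0 hb0 hc0 hd0 hk0'
    have hj0 : j = 0 := by unfold Adm at habj; omega
    subst hj0
    simp [sixjKL_zero]
  -- level `k ≥ 1`
  have hjk : j ≤ k := by unfold Adm at habj; omega
  have hjc : j ∈ colSet k a b c d := (mem_colSet k).mpr ⟨hjk, habj, hcdj⟩
  -- the second symbol as a function of the row
  have hsnd : ∀ i, sixjKL k d a k' b c i =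
      if Adm k a d i ∧ Adm k b c i ∧ Adm k a b k' ∧ Adm k c d k' then
        tetNet k a b i c d k' * klDelta k k' / (thetaNet k d c k' * thetaNet k a b k') else 0 := by
    intro i
    unfold sixjKL
    rw [tetNet_perm2]
    have e : (Adm k d c k' ∧ Adm k a b k' ∧ Adm k d a i ∧ Adm k b c i) ↔
        (Adm k a d i ∧ Adm k b c i ∧ Adm k a b k' ∧ Adm k c d k') := by
      rw [show Adm k d c k' ↔ Adm k c d k' from adm_comm k, show Adm k d a i ↔ Adm k a d i from adm_comm k]
      tauto
    rw [if_congr e rfl rfl]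
  by_cases hk'c : k' ∈ colSet k a b c d
  · -- `k'` is a column: reduce to `racahSum_gram`
    have hk'' := (mem_colSet k).mp hk'c
    obtain ⟨_, habk, hcdk⟩ := hk''
    -- restrict the sum to the rows, and evaluate each term through `tetNet_eq_fg` and the row weight
    have hE : qFactorial k a * qFactorial k b * qFactorial k c * qFactorial k d ≠ 0 :=
      mul_ne_zero (mul_ne_zero (mul_ne_zero (qFactorial_pos k (by omega)).ne' (qFactorial_pos k (by omega)).ne')
        (qFactorial_pos k (by omega)).ne') (qFactorial_pos k (by omega)).ne'
    have hθ2 : thetaNet k d c k' * thetaNet k a b k' ≠ 0 :=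
      mul_ne_zero (thetaNet_ne_zero k ((adm_comm k).mp hcdk)) (thetaNet_ne_zero k habk)
    have hterm : ∀ i ∈ range (k + 1), sixjKL k a b i c d j * sixjKL k d a k' b c i =
        if Adm k a d i ∧ Adm k b c i then
          (gFun k a b c d j * gFun k a b c d k' * klDelta k k' * (-1 : ℝ) ^ ((a + b + c + d) / 2) /
            (thetaNet k d c k' * thetaNet k a b k' *
              (qFactorial k a * qFactorial k b * qFactorial k c * qFactorial k d))) *
          (racahV k a d c b i * racahSum k a b j c d i * racahSum k a b k' c d i) else 0 := by
      intro i _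
      rw [hsnd i]
      unfold sixjKL
      by_cases hrow : Adm k a d i ∧ Adm k b c i
      · rw [if_pos ⟨hrow.1, hrow.2, habj, hcdj⟩, if_pos ⟨hrow.1, hrow.2, habk, hcdk⟩, if_pos hrow,
          tetNet_eq_fg k hrow.1 hrow.2 habj hcdj, tetNet_eq_fg k hrow.1 hrow.2 habk hcdk]
        have hW := sixj_row_weight k (a := a) (b := b) (c := c) (d := d) hrow.1 hrow.2
        have hθ1 : thetaNet k a d i * thetaNet k b c i ≠ 0 :=
          mul_ne_zero (thetaNet_ne_zero k hrow.1) (thetaNet_ne_zero k hrow.2)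
        rw [div_mul_eq_mul_div, div_eq_iff hθ1] at hW
        generalize thetaNet k a d i * thetaNet k b c i = Θ₁ at *
        generalize thetaNet k d c k' * thetaNet k a b k' = Θ₂ at *
        generalize qFactorial k a * qFactorial k b * qFactorial k c * qFactorial k d = E at *
        generalize fFun k a b c d i = F at *
        generalize gFun k a b c d j = Gj at *
        generalize gFun k a b c d k' = Gk at *
        generalize klDelta k i = Δi at *
        generalize klDelta k k' = Δk at *
        generalize racahSum k a b j c d i = Sj at *
        generalize racahSum k a b k' c d i = Sk at *
        generalize racahV k a d c b i = V at *
        generalize (-1 : ℝ) ^ ((a + b + c + d) / 2) = σ at *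
        field_simp
        linear_combination Gj * Sj * Gk * Sk * Δk * hW
      · rw [if_neg (fun h => hrow ⟨h.1, h.2.1⟩), if_neg hrow, zero_mul]
    rw [sum_congr rfl hterm, ← sum_filter, show (range (k + 1)).filter (fun i => Adm k a d i ∧ Adm k b c i) =
      rowSet k a b c d from rfl, ← mul_sum, racahSum_gram k hk ha hb hc hd hjc hk'c]
    by_cases hjk' : j = k'
    · subst hjk'
      rw [if_pos rfl, if_pos rfl]
      have hU := sixj_col_weight k habj hcdj
      have hv : racahV k a b c d j ≠ 0 := racahV_ne_zero k habj hcdj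
      have hσ : ((-1 : ℝ) ^ ((a + b + c + d) / 2)) ^ 2 = 1 := by rw [← pow_mul, mul_comm, pow_mul]; simp
      rw [div_mul_eq_mul_div, div_eq_iff hθ2] at hU
      generalize (-1 : ℝ) ^ ((a + b + c + d) / 2) = σ at *
      generalize qFactorial k a * qFactorial k b * qFactorial k c * qFactorial k d = E at *
      generalize thetaNet k d c j * thetaNet k a b j = Θ at *
      generalize racahV k a b c d j = V at *
      generalize gFun k a b c d j = G at *
      generalize klDelta k j = Δ at *
      field_simp
      linear_combination σ * hU + E * V * Θ * hσ
    · rw [if_neg hjk', if_neg (Ne.symm hjk'), mul_zero]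
  · -- `k'` is not a column: every term vanishes, and `k' ≠ j`
    have hne : k' ≠ j := fun h => hk'c (h ▸ hjc)
    rw [if_neg hne]
    refine sum_eq_zero fun i _ => ?_
    rw [hsnd i, if_neg, mul_zero]
    rintro ⟨_, _, habk, hcdk⟩
    exact hk'c ((mem_colSet k).mpr ⟨hk', habk, hcdk⟩)

/-! ## The pentagon identity (`KLPentagon_holds`) from the Temperley–Lieb recoupling theorem

KL's own proof of [cite: KauffmanLins1994, §7.3 Prop. 10] is the recoupling theorem in the Temperley–Lieb category at the
root of unity, which the tree has in the binor model (`TemperleyLieb/*.lean`: `pentagon_klA` for the recoupling coefficients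
`Fco (klA k)`, their closed form `Fco_klA_eq_sixjR`, and their vanishing off the q-admissible tetrahedra
`Fco_klA_eq_zero_of_not_adm`). Here we only bridge the real closed formula `sixjKL` of `KLRecoupling.lean` to
`Fco (klA k)`: `[n]_{A₀} = [n]` (`qInt_klA`), `[n]!_{A₀} = [n]!` (`qFactorial_klA`), the binor Racah sum is the finite
alternating sum of `tetNet` (`SZ_klA_eq_sum_Icc`), and `{a b i; c d j}_q = F^{abc}_{d;ji}(A₀)` (`sixjKL_eq_Fco`, the common
factorials of `Tet·Δ/(θθ)` cancelled as in `sixjP`). The printed pentagon is `pentagon_klA` after five uses of the symmetry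
`sixjKL_swap`. (This section restores the discharge of `KLPentagon` that an earlier whole-file resubmission of this module had
dropped; same statement, same route.) -/

section Pentagon

open TemperleyLieb TemperleyLieb.Mor

/-- At `A₀ = e^{iπ/2(k+2)}` the binor-model quantum integer is the real `[n] = sin(nπ/(k+2))/sin(π/(k+2))`.
[cite: KauffmanLins1994, §9.4] -/
theorem qInt_klA (n : ℕ) : ((qInt k n : ℝ) : ℂ) = qint (klA k) n := by
  rw [qint_klA]; rfl

/-- The same for the quantum factorials `[n]!`. [cite: KauffmanLins1994, §9.10] -/
theorem qFactorial_klA (n : ℕ) : ((qFactorial k n : ℝ) : ℂ) = qfact (klA k) n := by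
  induction n with
  | zero => rw [qFactorial_zero, qfact_zero]; push_cast; rfl
  | succ n ih => rw [qFactorial_succ, qfact_succ, Complex.ofReal_mul, ih, qInt_klA]

/-- The binor-model Racah sum at `A₀` with natural parameters is the finite alternating sum of the tetrahedral net over
`max aᵢ ≤ s ≤ min bⱼ` (the terms outside vanish since `1/[m]! = 0` for `m < 0`). [cite: KauffmanLins1994, §9.11] -/
theorem SZ_klA_eq_sum_Icc (α₁ α₂ α₃ α₄ β₁ β₂ β₃ N : ℕ) (hN : min (min β₁ β₂) β₃ ≤ N) :
    SZ (klA k) α₁ α₂ α₃ α₄ β₁ β₂ β₃ N =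
      ∑ s ∈ Icc (max (max α₁ α₂) (max α₃ α₄)) (min (min β₁ β₂) β₃),
        (-1 : ℂ) ^ s * qfact (klA k) (s + 1) /
          (qfact (klA k) (s - α₁) * qfact (klA k) (s - α₂) * qfact (klA k) (s - α₃) * qfact (klA k) (s - α₄) *
            qfact (klA k) (β₁ - s) * qfact (klA k) (β₂ - s) * qfact (klA k) (β₃ - s)) := by
  have hsub : Icc (max (max α₁ α₂) (max α₃ α₄)) (min (min β₁ β₂) β₃) ⊆ range (N + 1) := by
    intro s hs
    rw [Finset.mem_Icc] at hs
    rw [Finset.mem_range]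
    have := hs.2
    rw [le_min_iff, le_min_iff] at this
    omega
  have hzero : ∀ s ∈ range (N + 1), s ∉ Icc (max (max α₁ α₂) (max α₃ α₄)) (min (min β₁ β₂) β₃) →
      tZ (klA k) (α₁ : ℤ) α₂ α₃ α₄ β₁ β₂ β₃ (s : ℤ) = 0 := by
    intro s _ hs
    rw [Finset.mem_Icc, not_and_or, not_le, not_le] at hs
    rcases hs with h | h
    · rw [lt_max_iff, lt_max_iff, lt_max_iff] at h
      rcases h with (h | h) | (h | h)
      · exact tZ_eq_zero_of_lt_a (Or.inl rfl) (by exact_mod_cast h)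
      · exact tZ_eq_zero_of_lt_a (Or.inr (Or.inl rfl)) (by exact_mod_cast h)
      · exact tZ_eq_zero_of_lt_a (Or.inr (Or.inr (Or.inl rfl))) (by exact_mod_cast h)
      · exact tZ_eq_zero_of_lt_a (Or.inr (Or.inr (Or.inr rfl))) (by exact_mod_cast h)
    · rw [min_lt_iff, min_lt_iff] at h
      rcases h with (h | h) | h
      · exact tZ_eq_zero_of_b_lt (Or.inl rfl) (by exact_mod_cast h)
      · exact tZ_eq_zero_of_b_lt (Or.inr (Or.inl rfl)) (by exact_mod_cast h)
      · exact tZ_eq_zero_of_b_lt (Or.inr (Or.inr rfl)) (by exact_mod_cast h)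
  unfold SZ
  rw [← Finset.sum_subset hsub hzero]
  refine Finset.sum_congr rfl (fun s hs => ?_)
  rw [Finset.mem_Icc, max_le_iff, max_le_iff, max_le_iff, le_min_iff, le_min_iff] at hs
  obtain ⟨⟨⟨h1, h2⟩, h3, h4⟩, ⟨h5, h6⟩, h7⟩ := hs
  unfold tZ
  rw [← Nat.cast_sub h1, ← Nat.cast_sub h2, ← Nat.cast_sub h3, ← Nat.cast_sub h4, ← Nat.cast_sub h5,
    ← Nat.cast_sub h6, ← Nat.cast_sub h7, qfinv_natCast, qfinv_natCast, qfinv_natCast, qfinv_natCast,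
    qfinv_natCast, qfinv_natCast, qfinv_natCast, show ((s : ℤ) + 1) = ((s + 1 : ℕ) : ℤ) by push_cast; ring,
    qfactZ_natCast, zpow_natCast]
  simp only [div_eq_mul_inv, mul_inv]
  ring

/-- `x / ((-1)^m P₁ · (-1)^n P₂) = (-1)^m (-1)^n · x/(P₁ P₂)` (signs are their own inverses). [folklore] -/
theorem div_signs (x P₁ P₂ : ℝ) (m n : ℕ) :
    x / ((-1 : ℝ) ^ m * P₁ * ((-1 : ℝ) ^ n * P₂)) = (-1 : ℝ) ^ m * (-1 : ℝ) ^ n * (x / (P₁ * P₂)) := by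
  have h1 : ((-1 : ℝ) ^ m)⁻¹ = (-1) ^ m := by rw [← inv_pow, inv_neg_one]
  have h2 : ((-1 : ℝ) ^ n)⁻¹ = (-1) ^ n := by rw [← inv_pow, inv_neg_one]
  simp only [div_eq_mul_inv, mul_inv, h1, h2]
  ring

set_option maxHeartbeats 1600000 in
/-- **The Kauffman–Lins q-6j symbol is the recoupling coefficient of the Temperley–Lieb category at the root of
unity**: `{a b i; c d j}_q = F^{abc}_{d;ji}(A₀)` for all labels `≤ k` (both vanish off the q-admissible tetrahedra;
on them, the closed formula `Tet·Δ_i/(θ(a,d,i)θ(b,c,i))` of [cite: KauffmanLins1994, §9.11–§9.12] is the binor model's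
`sixjR` by cancelling the common factorials). [cite: KauffmanLins1994, §7.3 Prop. 11, §9.12] -/
theorem sixjKL_eq_Fco {a b c d i j : ℕ} (ha : a ≤ k) (hb : b ≤ k) (hc : c ≤ k) (hd : d ≤ k) (hi : i ≤ k)
    (hj : j ≤ k) : ((sixjKL k a b i c d j : ℝ) : ℂ) = Fco (klA k) a b c d j i := by
  by_cases hadm : Adm k a d i ∧ Adm k b c i ∧ Adm k a b j ∧ Adm k c d j
  swap
  · rw [Fco_klA_eq_zero_of_not_adm k ha hb hc hd hj hi]
    · rw [sixjKL, if_neg hadm, Complex.ofReal_zero]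
    · intro h
      apply hadm
      obtain ⟨h1, h2, h3, h4⟩ := h
      unfold TemperleyLieb.Tri at h1 h2 h3 h4
      refine ⟨?_, ?_, ?_, ?_⟩
      · unfold Adm; omega
      · unfold Adm; omega
      · unfold Adm; omega
      · unfold Adm; omega
  obtain ⟨hadi, hbci, habj, hcdj⟩ := hadm
  have h1 : TemperleyLieb.Tri a b j ∧ a + b + j ≤ 2 * k := by unfold Adm at habj; unfold TemperleyLieb.Tri; omega
  have h2 : TemperleyLieb.Tri j c d ∧ j + c + d ≤ 2 * k := by unfold Adm at hcdj; unfold TemperleyLieb.Tri; omega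
  have h3 : TemperleyLieb.Tri b c i ∧ b + c + i ≤ 2 * k := by unfold Adm at hbci; unfold TemperleyLieb.Tri; omega
  have h4 : TemperleyLieb.Tri a i d ∧ a + i + d ≤ 2 * k := by unfold Adm at hadi; unfold TemperleyLieb.Tri; omega
  rw [sixjKL, if_pos ⟨hadi, hbci, habj, hcdj⟩, Fco_klA_eq_sixjR k ha hb hc hd hj hi h1 h2 h3 h4,
    sixjR_of_tri ⟨h1.1, h2.1, h3.1, h4.1⟩, thetaNet_eq_sign_mul k hadi, thetaNet_eq_sign_mul k hbci, div_signs]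
  clear h1 h2 h3 h4
  unfold Adm at hadi hbci habj hcdj
  obtain ⟨p1, t1, t2, t3, l1⟩ := hadi
  obtain ⟨p2, s1, s2, s3, l2⟩ := hbci
  obtain ⟨p3, u1, u2, u3, l3⟩ := habj
  obtain ⟨p4, w1, w2, w3, l4⟩ := hcdj
  -- the integer parameters (no parities, no divisions left afterwards)
  obtain ⟨α₁, hα₁⟩ : ∃ t, a + d + i = 2 * t := ⟨(a + d + i) / 2, by omega⟩
  obtain ⟨α₂, hα₂⟩ : ∃ t, b + c + i = 2 * t := ⟨(b + c + i) / 2, by omega⟩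
  obtain ⟨α₃, hα₃⟩ : ∃ t, a + b + j = 2 * t := ⟨(a + b + j) / 2, by omega⟩
  obtain ⟨α₄, hα₄⟩ : ∃ t, c + d + j = 2 * t := ⟨(c + d + j) / 2, by omega⟩
  obtain ⟨β₁, hβ₁⟩ : ∃ t, b + d + i + j = 2 * t := ⟨(b + d + i + j) / 2, by omega⟩
  obtain ⟨β₂, hβ₂⟩ : ∃ t, a + c + i + j = 2 * t := ⟨(a + c + i + j) / 2, by omega⟩
  obtain ⟨β₃, hβ₃⟩ : ∃ t, a + b + c + d = 2 * t := ⟨(a + b + c + d) / 2, by omega⟩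
  obtain ⟨m₁, hm₁⟩ : ∃ t, a + d - i = 2 * t := ⟨(a + d - i) / 2, by omega⟩
  obtain ⟨n₁, hn₁⟩ : ∃ t, d + i - a = 2 * t := ⟨(d + i - a) / 2, by omega⟩
  obtain ⟨p₁, hp₁⟩ : ∃ t, a + i - d = 2 * t := ⟨(a + i - d) / 2, by omega⟩
  obtain ⟨m₂, hm₂⟩ : ∃ t, b + c - i = 2 * t := ⟨(b + c - i) / 2, by omega⟩
  obtain ⟨n₂, hn₂⟩ : ∃ t, c + i - b = 2 * t := ⟨(c + i - b) / 2, by omega⟩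
  obtain ⟨p₂, hp₂⟩ : ∃ t, b + i - c = 2 * t := ⟨(b + i - c) / 2, by omega⟩
  clear p1 p2 p3 p4
  unfold tetNet klDelta
  simp only
  rw [show (a + d + i) / 2 = α₁ by omega, show (b + c + i) / 2 = α₂ by omega, show (a + b + j) / 2 = α₃ by omega,
    show (c + d + j) / 2 = α₄ by omega, show (b + d + i + j) / 2 = β₁ by omega,
    show (a + c + i + j) / 2 = β₂ by omega, show (a + b + c + d) / 2 = β₃ by omega,
    show (a + d - i) / 2 = m₁ by omega, show (d + i - a) / 2 = n₁ by omega, show (a + i - d) / 2 = p₁ by omega,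
    show (b + c - i) / 2 = m₂ by omega, show (c + i - b) / 2 = n₂ by omega, show (b + i - c) / 2 = p₂ by omega]
  rw [show β₁ - α₁ = α₃ - a by omega, show β₁ - α₂ = α₄ - c by omega, show β₁ - α₃ = n₁ by omega,
    show β₁ - α₄ = p₂ by omega, show β₂ - α₁ = α₄ - d by omega, show β₂ - α₂ = α₃ - b by omega,
    show β₂ - α₃ = n₂ by omega, show β₂ - α₄ = p₁ by omega, show β₃ - α₁ = m₂ by omega,
    show β₃ - α₂ = m₁ by omega, show β₃ - α₃ = α₄ - j by omega, show β₃ - α₄ = α₃ - j by omega]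
  -- the binor side: integer arguments are naturals
  unfold sixjP
  rw [show ((i : ℤ) + (α₁ : ℤ) + (α₂ : ℤ)) = ((i + α₁ + α₂ : ℕ) : ℤ) by push_cast; ring, zpow_natCast,
    show ((i : ℤ) + 1) = ((i + 1 : ℕ) : ℤ) by push_cast; ring,
    show ((α₃ : ℤ) - (a : ℤ)) = ((α₃ - a : ℕ) : ℤ) by omega, show ((α₃ : ℤ) - (b : ℤ)) = ((α₃ - b : ℕ) : ℤ) by omega,
    show ((α₃ : ℤ) - (j : ℤ)) = ((α₃ - j : ℕ) : ℤ) by omega, show ((α₄ : ℤ) - (d : ℤ)) = ((α₄ - d : ℕ) : ℤ) by omega,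
    show ((α₄ : ℤ) - (c : ℤ)) = ((α₄ - c : ℕ) : ℤ) by omega, show ((α₄ : ℤ) - (j : ℤ)) = ((α₄ - j : ℕ) : ℤ) by omega,
    show ((α₁ : ℤ) + (α₃ : ℤ) - (a : ℤ)) = ((β₁ : ℕ) : ℤ) by omega,
    show ((α₁ : ℤ) + (α₄ : ℤ) - (d : ℤ)) = ((β₂ : ℕ) : ℤ) by omega,
    show ((α₁ : ℤ) + (α₂ : ℤ) - (i : ℤ)) = ((β₃ : ℕ) : ℤ) by omega,
    show ((α₁ : ℤ) + 1) = ((α₁ + 1 : ℕ) : ℤ) by push_cast; ring,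
    show ((α₂ : ℤ) + 1) = ((α₂ + 1 : ℕ) : ℤ) by push_cast; ring, Int.toNat_natCast]
  simp only [qfactZ_natCast]
  rw [SZ_klA_eq_sum_Icc k α₁ α₂ α₃ α₄ β₁ β₂ β₃ β₁ (le_trans (min_le_left _ _) (min_le_left _ _))]
  -- the real side, cast
  push_cast
  simp only [qFactorial_klA, qInt_klA]
  rw [qfact_succ (klA k) i, pow_add, pow_add]
  -- nonvanishing of the factorials that are cancelled
  have hF : ∀ n, n ≤ k + 1 → qfact (klA k) n ≠ 0 := fun n hn => qfact_klA_ne_zero k hn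
  have hFa := hF a (by omega)
  have hFb := hF b (by omega)
  have hFc := hF c (by omega)
  have hFd := hF d (by omega)
  have hFi := hF i (by omega)
  have hFj := hF j (by omega)
  have hFα₁ := hF (α₁ + 1) (by omega)
  have hFα₂ := hF (α₂ + 1) (by omega)
  have hFm₁ := hF m₁ (by omega)
  have hFn₁ := hF n₁ (by omega)
  have hFp₁ := hF p₁ (by omega)
  have hFm₂ := hF m₂ (by omega)
  have hFn₂ := hF n₂ (by omega)
  have hFp₂ := hF p₂ (by omega)
  generalize (∑ s ∈ Icc (max (max α₁ α₂) (max α₃ α₄)) (min (min β₁ β₂) β₃),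
    (-1 : ℂ) ^ s * qfact (klA k) (s + 1) /
      (qfact (klA k) (s - α₁) * qfact (klA k) (s - α₂) * qfact (klA k) (s - α₃) * qfact (klA k) (s - α₄) *
        qfact (klA k) (β₁ - s) * qfact (klA k) (β₂ - s) * qfact (klA k) (β₃ - s))) = S
  generalize qfact (klA k) a = Fa at *
  generalize qfact (klA k) b = Fb at *
  generalize qfact (klA k) c = Fc at *
  generalize qfact (klA k) d = Fd at *
  generalize qfact (klA k) i = Fi at *
  generalize qfact (klA k) j = Fj at *
  generalize qfact (klA k) (α₁ + 1) = Gα₁ at *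
  generalize qfact (klA k) (α₂ + 1) = Gα₂ at *
  generalize qfact (klA k) m₁ = Fm₁ at *
  generalize qfact (klA k) n₁ = Fn₁ at *
  generalize qfact (klA k) p₁ = Fp₁ at *
  generalize qfact (klA k) m₂ = Fm₂ at *
  generalize qfact (klA k) n₂ = Fn₂ at *
  generalize qfact (klA k) p₂ = Fp₂ at *
  generalize qfact (klA k) (α₃ - a) = G₁
  generalize qfact (klA k) (α₃ - b) = G₂
  generalize qfact (klA k) (α₃ - j) = G₃
  generalize qfact (klA k) (α₄ - d) = G₄
  generalize qfact (klA k) (α₄ - c) = G₅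
  generalize qfact (klA k) (α₄ - j) = G₆
  generalize qint (klA k) (i + 1) = Q
  generalize (-1 : ℂ) ^ α₁ = σ₁
  generalize (-1 : ℂ) ^ α₂ = σ₂
  generalize (-1 : ℂ) ^ i = σ
  field_simp

/-- **The Kauffman–Lins pentagon (Biedenharn–Elliott) identity holds**:
`Σ_m {a i m; d e j}_q {b c l; d m i}_q {b l k'; e a m}_q = {b c k'; j a i}_q {k' c l; d e j}_q` at `q = e^{iπ/(k+2)}`, all
labels `≤ k`, the sum over `m ≤ k`. It is the truncated pentagon `pentagon_klA` of the Temperley–Lieb recoupling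
coefficients at `A₀` (with `(a,b,c,d,e,f,g,k',l') := (d,e,a,b,c,j,i,l,k')`) transported along `sixjKL_eq_Fco` and five
instances of the symmetry `sixjKL_swap`. [cite: KauffmanLins1994, §7.3 Prop. 10 (Pentagon Identity), §9.14] -/
theorem KLPentagon_holds : KLPentagon k := by
  intro a b c d e i j k' l ha hb hc hd he hi hj hk' hl
  apply Complex.ofReal_injective
  rw [sixjKL_swap k j a k' b c i, sixjKL_swap k d e l k' c j]
  push_cast
  rw [sixjKL_eq_Fco k hj ha hb hc hk' hi, sixjKL_eq_Fco k hd he hk' hc hl hj,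
    pentagon_klA k hd he ha hb hc hj hi l k' hl hk']
  refine Finset.sum_congr rfl (fun m hm => ?_)
  have hm' : m ≤ k := Nat.lt_succ_iff.mp (Finset.mem_range.mp hm)
  rw [sixjKL_swap k d e m a i j, sixjKL_swap k d m l b c i, sixjKL_swap k e a k' b l m,
    sixjKL_eq_Fco k hd he ha hi hm' hj, sixjKL_eq_Fco k hd hm' hb hc hl hi, sixjKL_eq_Fco k he ha hb hl hk' hm']

end Pentagon

end Literature.RepresentationTheory.ModularTensorCategories.SU2LevelK
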